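import Summits.HubbardSuperconductivity.HubbardSuperconductivity.Theorems.SoloBlindPairCondensate
import Literature.MathematicalPhysics.QuantumLattice.FreeFermionSectorGroundStates
import HarnessLib

/-!
# The weighted (number-projected BCS / AGP) pair condensate: norm, kinetic energy, order
(solo-blind programme, Theorem 26)

`SoloBlindPairCondensate` evaluated the order functional `re ⟨Ψ, ΔᴴΔ Ψ⟩`
(`Δ = pairField dWaveFormFactor L = -Σ_k w_k b_k`) on the SIGNED UNIFORM condensate over a momentum
set.  Here the amplitudes are arbitrary real weights `φ : TorusSite 2 L → ℝ`:

  `Ψ^φ_{A,i} = Σ_{S ⊆ A, |S| = i} (Π_{k∈S} φ_k) Φ_S`,   `Φ_S = Π_{k∈S} b†_k |∅⟩`,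

the particle-number projection of the BCS state `Π_k (1 + φ_k b†_k)|∅⟩` onto `i` pairs
(Bardeen–Cooper–Schrieffer 1957 §II; the "antisymmetrised geminal power").  With `x_k = φ_k²` and
the elementary symmetric sums `e_j(x; B) = Σ_{T ⊆ B, |T| = j} Π_T x`:

* `star_paired_dotProduct_wcond`, `star_wcond_dotProduct_self` : `⟨Φ_T, Ψ^φ_{A,i}⟩ = [T ⊆ A,
  |T| = i] Π_T φ` and `‖Ψ^φ_{A,i}‖² = e_i(x; A)`;
* `re_expect_hubbardTorus_zero_wcond` : the free kinetic energy
  `re ⟨Ψ, H₀ Ψ⟩ = 2 Σ_{S} (Π_S x) Σ_{k∈S} ε_k` (`H₀ = hubbardTorus 2 L 1 0`, `L ≥ 3`);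
* `star_paired_dotProduct_pairField_mulVec_wcond` : `⟨Φ_T, Δ Ψ^φ_{A,j+1}⟩ =
  -(Π_T φ) Σ_{k ∈ A∖T} w_k φ_k` — with `φ_k = sign(w_k) √x_k` every channel adds up;
* `wcond_order_ge` : by Cauchy–Schwarz against `Ψ^φ_{A,j}`,
  **`(Σ_{T ⊆ A,|T|=j} (Π_T x) Σ_{k∈A∖T} w_k φ_k)² ≤ e_j(x;A) · re ⟨Ψ^φ_{A,j+1}, ΔᴴΔ Ψ^φ_{A,j+1}⟩`**;
* `sum_prod_mul_sum_sdiff_eq` : the channel sum rewritten mode by mode,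
  `Σ_T (Π_T x) Σ_{k∈A∖T} f_k = Σ_{k∈A} f_k e_j(x; A∖k)`, i.e. in terms of the canonical
  occupations `x_k e_j(x; A∖k)/e_{j+1}(x; A)` controlled by `SoloBlindCanonicalOccupation`.

Together with the occupation sandwich this is the machinery for running a genuine BCS profile
inside a fixed sector uniformly in `L` (report §5.20 (5), claim C53).  References: J. Bardeen,
L. N. Cooper, J. R. Schrieffer, Phys. Rev. 108 (1957) 1175, §II and Appendix A (projected
state); A. J. Coleman, J. Math. Phys. 6 (1965) 1425 (AGP). [this work: the formalisation and the
Cauchy–Schwarz evaluation]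
-/

noncomputable section

namespace Summit.HubbardSuperconductivity.HubbardSuperconductivity.Theorems.WeightedCondensate

open Matrix Finset Literature.Probability.LatticeModels
  Literature.MathematicalPhysics.QuantumLattice
  Summit.HubbardSuperconductivity.HubbardSuperconductivity.Theorems.PairCondensate
open scoped ComplexOrder ComplexConjugate

variable {L : ℕ} [NeZero L]

omit [NeZero L] in
/-- `⟨x, A y⟩ = ⟨Aᴴ x, y⟩`. [folklore] -/
private theorem star_dotProduct_mulVec_eq' {ι : Type*} [Fintype ι] (A : Matrix ι ι ℂ)
    (x y : ι → ℂ) : star x ⬝ᵥ (A *ᵥ y) = star (Aᴴ *ᵥ x) ⬝ᵥ y := by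
  rw [star_mulVec, conjTranspose_conjTranspose, dotProduct_mulVec]

/-- The paired vector `Φ_S = Π_{k∈S} b†_k |∅⟩` of a finite momentum set (literal term). -/
local notation "Φ[" S "]" =>
  (List.prod (List.map (fun k : TorusSite 2 _ => (pairMode k)ᴴ) (Finset.toList S)) *ᵥ
    (vacuum : Fock (Orb (FermionTorus 2 _))))

/-- The `d`-wave profile `w_k = pairFieldMode dWaveFormFactor L k`. -/
local notation "W[" k "]" => (pairFieldMode dWaveFormFactor _ k)

/-- The weighted number-projected condensate `Ψ^φ_{A,i} = Σ_{S ⊆ A, |S| = i} (Π_{k∈S} φ_k) Φ_S`. -/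
local notation "Ψ[" φ ", " A " ; " i "]" =>
  (∑ S ∈ Finset.powersetCard i A, ((((∏ k ∈ S, φ k : ℝ))) : ℂ) • Φ[S])

/-- `esy[x, s, j]` = the `j`-th elementary symmetric sum of the weights `x` over `s`. -/
local notation "esy[" x ", " s ", " j "]" =>
  (∑ t ∈ Finset.powersetCard j s, ∏ k ∈ t, x k)

/-! ### Overlaps and the norm -/

/-- `⟨Φ_T, Ψ^φ_{A,i}⟩ = [T ⊆ A, |T| = i] Π_T φ`. [this work] -/
theorem star_paired_dotProduct_wcond (φ : TorusSite 2 L → ℝ) (A T : Finset (TorusSite 2 L))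
    (i : ℕ) :
    star Φ[T] ⬝ᵥ Ψ[φ, A ; i] =
      if T ∈ A.powersetCard i then ((((∏ k ∈ T, φ k : ℝ))) : ℂ) else 0 := by
  classical
  rw [dotProduct_sum]
  have h : ∀ S ∈ A.powersetCard i, star Φ[T] ⬝ᵥ (((((∏ k ∈ S, φ k : ℝ))) : ℂ) • Φ[S]) =
      if S = T then ((((∏ k ∈ S, φ k : ℝ))) : ℂ) else 0 := by
    intro S _
    rw [dotProduct_smul, star_paired_dotProduct_paired, smul_eq_mul, mul_ite, mul_one, mul_zero]
  rw [Finset.sum_congr rfl h, Finset.sum_ite_eq']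

omit [NeZero L] in
/-- `(Π_S φ)² = Π_S φ²`. [folklore] -/
theorem prod_mul_prod_eq_prod_sq (φ : TorusSite 2 L → ℝ) (S : Finset (TorusSite 2 L)) :
    (∏ k ∈ S, φ k) * (∏ k ∈ S, φ k) = ∏ k ∈ S, φ k ^ 2 := by
  rw [← Finset.prod_mul_distrib]
  exact Finset.prod_congr rfl fun k _ => (sq (φ k)).symm

/-- **`‖Ψ^φ_{A,i}‖² = e_i(φ²; A)`.** [this work] -/
theorem star_wcond_dotProduct_self (φ : TorusSite 2 L → ℝ) (A : Finset (TorusSite 2 L)) (i : ℕ) :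
    star Ψ[φ, A ; i] ⬝ᵥ Ψ[φ, A ; i] = (((esy[fun k => φ k ^ 2, A, i] : ℝ)) : ℂ) := by
  classical
  rw [star_sum, sum_dotProduct, Complex.ofReal_sum]
  refine Finset.sum_congr rfl fun S hS => ?_
  rw [star_smul, smul_dotProduct, star_paired_dotProduct_wcond, if_pos hS, Complex.star_def,
    Complex.conj_ofReal, smul_eq_mul, ← Complex.ofReal_mul, prod_mul_prod_eq_prod_sq]

/-- The real part: `re ⟨Ψ, Ψ⟩ = e_i(φ²; A)`. [this work] -/
theorem re_star_wcond_dotProduct_self (φ : TorusSite 2 L → ℝ) (A : Finset (TorusSite 2 L))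
    (i : ℕ) : (star Ψ[φ, A ; i] ⬝ᵥ Ψ[φ, A ; i]).re = esy[fun k => φ k ^ 2, A, i] := by
  rw [star_wcond_dotProduct_self, Complex.ofReal_re]

/-- `Ψ^φ_{A,i}` lies in the joint sector `(2i, S^z = 0)`. [this work] -/
theorem wcond_mem_szSector (φ : TorusSite 2 L → ℝ) (A : Finset (TorusSite 2 L)) (i : ℕ) :
    Ψ[φ, A ; i] ∈ szSector (Λ := FermionTorus 2 L) (2 * i) 0 := by
  classical
  refine Submodule.sum_mem _ fun S hS => Submodule.smul_mem _ _ ?_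
  have h := pairedState_mem_szSector S.toList
  rwa [Finset.length_toList, (Finset.mem_powersetCard.1 hS).2] at h

/-- `Ψ^φ_{A,i} ≠ 0` as soon as `e_i(φ²; A) ≠ 0`. [this work] -/
theorem wcond_ne_zero (φ : TorusSite 2 L → ℝ) (A : Finset (TorusSite 2 L)) {i : ℕ}
    (hi : esy[fun k => φ k ^ 2, A, i] ≠ 0) : Ψ[φ, A ; i] ≠ 0 := by
  intro h0
  have h := star_wcond_dotProduct_self φ A i
  rw [h0, star_zero, zero_dotProduct] at h
  exact hi (by exact_mod_cast h.symm)

/-! ### Kinetic energy -/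

/-- **Free kinetic energy of the weighted condensate**: for `L ≥ 3`,
`re ⟨Ψ^φ_{A,i}, H₀ Ψ^φ_{A,i}⟩ = 2 Σ_{S ⊆ A, |S| = i} (Π_S φ²) Σ_{k∈S} ε_L(k)`
(`H₀ Φ_S = 2(Σ_{k∈S} ε_k) Φ_S` and orthogonality). [this work] -/
theorem re_expect_hubbardTorus_zero_wcond (hL : 3 ≤ L) (φ : TorusSite 2 L → ℝ)
    (A : Finset (TorusSite 2 L)) (i : ℕ) :
    (star Ψ[φ, A ; i] ⬝ᵥ (hubbardTorus 2 L 1 0 *ᵥ Ψ[φ, A ; i])).re =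
      2 * ∑ S ∈ A.powersetCard i, (∏ k ∈ S, φ k ^ 2) * ∑ k ∈ S, torusBand L k := by
  classical
  have hH : hubbardTorus 2 L 1 0 *ᵥ Ψ[φ, A ; i] =
      ∑ S ∈ A.powersetCard i,
        (((((∏ k ∈ S, φ k) * (2 * ∑ k ∈ S, torusBand L k) : ℝ))) : ℂ) • Φ[S] := by
    rw [mulVec_sum]
    refine Finset.sum_congr rfl fun S _ => ?_
    rw [mulVec_smul, hubbardTorus_zero_mulVec_pairedState hL, Finset.toList_toFinset, smul_smul,
      ← Complex.ofReal_mul]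
  rw [hH, dotProduct_sum, Complex.re_sum, Finset.mul_sum]
  refine Finset.sum_congr rfl fun S hS => ?_
  rw [dotProduct_smul, star_dotProduct, star_paired_dotProduct_wcond, if_pos hS, Complex.star_def,
    Complex.conj_ofReal, smul_eq_mul, ← Complex.ofReal_mul, Complex.ofReal_re,
    ← prod_mul_prod_eq_prod_sq]
  ring

/-! ### The pair field on the weighted condensate -/

/-- **Channel amplitudes**: for `T ⊆ A` with `|T| = j`,
`⟨Φ_T, Δ Ψ^φ_{A,j+1}⟩ = -(Π_T φ) · Σ_{k ∈ A∖T} w_k φ_k`. [this work] -/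
theorem star_paired_dotProduct_pairField_mulVec_wcond (φ : TorusSite 2 L → ℝ)
    {A T : Finset (TorusSite 2 L)} (hTA : T ⊆ A) {j : ℕ} (hTj : T.card = j) :
    star Φ[T] ⬝ᵥ (pairField dWaveFormFactor L *ᵥ Ψ[φ, A ; j + 1]) =
      -(((((∏ k ∈ T, φ k) * ∑ k ∈ A \ T, W[k] * φ k : ℝ))) : ℂ) := by
  classical
  rw [star_dotProduct_mulVec_eq', conjTranspose_pairField_mulVec_paired, star_neg, star_sum,
    neg_dotProduct, sum_dotProduct]
  have step : ∀ k ∈ Finset.univ \ T,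
      star ((((W[k] : ℝ)) : ℂ) • Φ[insert k T]) ⬝ᵥ Ψ[φ, A ; j + 1] =
        if k ∈ A then (((((∏ q ∈ T, φ q) * (W[k] * φ k) : ℝ))) : ℂ) else 0 := by
    intro k hk
    have hkT : k ∉ T := (Finset.mem_sdiff.1 hk).2
    rw [star_smul, smul_dotProduct, star_paired_dotProduct_wcond, Complex.star_def,
      Complex.conj_ofReal, smul_eq_mul]
    by_cases hkA : k ∈ A
    · have hmem : insert k T ∈ A.powersetCard (j + 1) := by
        rw [Finset.mem_powersetCard]
        exact ⟨Finset.insert_subset hkA hTA, by rw [Finset.card_insert_of_notMem hkT, hTj]⟩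
      rw [if_pos hmem, if_pos hkA, ← Complex.ofReal_mul, Finset.prod_insert hkT]
      push_cast
      ring
    · have hnmem : insert k T ∉ A.powersetCard (j + 1) := fun h =>
        hkA ((Finset.mem_powersetCard.1 h).1 (Finset.mem_insert_self k T))
      rw [if_neg hnmem, if_neg hkA, mul_zero]
  rw [Finset.sum_congr rfl step, Finset.sum_ite_mem]
  have hset : (Finset.univ \ T) ∩ A = A \ T := by
    ext k
    simp only [Finset.mem_inter, Finset.mem_sdiff, Finset.mem_univ, true_and]
    tauto
  rw [hset, Complex.ofReal_mul, Complex.ofReal_sum, Finset.mul_sum]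
  congr 1
  refine Finset.sum_congr rfl fun k _ => ?_
  push_cast
  ring

/-- **`⟨Ψ^φ_{A,j}, Δ Ψ^φ_{A,j+1}⟩ = -Σ_{T ⊆ A, |T| = j} (Π_T φ²) Σ_{k∈A∖T} w_k φ_k`.** [this work] -/
theorem star_wcond_dotProduct_pairField_mulVec_wcond (φ : TorusSite 2 L → ℝ)
    (A : Finset (TorusSite 2 L)) (j : ℕ) :
    star Ψ[φ, A ; j] ⬝ᵥ (pairField dWaveFormFactor L *ᵥ Ψ[φ, A ; j + 1]) =
      -(((∑ T ∈ A.powersetCard j, (∏ k ∈ T, φ k ^ 2) * ∑ k ∈ A \ T, W[k] * φ k : ℝ) : ℂ)) := by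
  classical
  rw [star_sum, sum_dotProduct]
  have h : ∀ T ∈ A.powersetCard j,
      star (((((∏ k ∈ T, φ k : ℝ))) : ℂ) • Φ[T]) ⬝ᵥ
          (pairField dWaveFormFactor L *ᵥ Ψ[φ, A ; j + 1]) =
        -((((∏ k ∈ T, φ k ^ 2) * ∑ k ∈ A \ T, W[k] * φ k : ℝ) : ℂ)) := by
    intro T hT
    obtain ⟨hTA, hTj⟩ := Finset.mem_powersetCard.1 hT
    rw [star_smul, smul_dotProduct, star_paired_dotProduct_pairField_mulVec_wcond φ hTA hTj,
      Complex.star_def, Complex.conj_ofReal, smul_eq_mul, mul_neg, ← Complex.ofReal_mul,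
      ← mul_assoc, prod_mul_prod_eq_prod_sq]
  rw [Finset.sum_congr rfl h, Finset.sum_neg_distrib, Complex.ofReal_sum]

/-- **Theorem 26 (the order functional of the weighted condensate).**
`(Σ_{T ⊆ A, |T| = j} (Π_T φ²) Σ_{k∈A∖T} w_k φ_k)² ≤ e_j(φ²; A) · re ⟨Ψ^φ_{A,j+1}, ΔᴴΔ Ψ^φ_{A,j+1}⟩`,
`Δ = pairField dWaveFormFactor L` (Cauchy–Schwarz against `Ψ^φ_{A,j}`, whose squared norm is
`e_j(φ²; A)`).  For `φ_k = sign(w_k) √x_k` the channel sum is `Σ_{k∈A} |w_k| √x_k e_j(x; A∖k)`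
(`sum_prod_mul_sum_sdiff_eq`). [this work] -/
theorem wcond_order_ge (φ : TorusSite 2 L → ℝ) (A : Finset (TorusSite 2 L)) (j : ℕ) :
    (∑ T ∈ A.powersetCard j, (∏ k ∈ T, φ k ^ 2) * ∑ k ∈ A \ T, W[k] * φ k) ^ 2 ≤
      esy[fun k => φ k ^ 2, A, j] *
        (star Ψ[φ, A ; j + 1] ⬝ᵥ
          ((pairField dWaveFormFactor L)ᴴ * pairField dWaveFormFactor L) *ᵥ Ψ[φ, A ; j + 1]).re := by
  classical
  set x := Ψ[φ, A ; j] with hx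
  set Ψ' := Ψ[φ, A ; j + 1] with hΨ'
  set y := pairField dWaveFormFactor L *ᵥ Ψ' with hy
  have hR : (star Ψ' ⬝ᵥ ((pairField dWaveFormFactor L)ᴴ * pairField dWaveFormFactor L) *ᵥ Ψ').re =
      (star y ⬝ᵥ y).re := by
    rw [hy, ← mulVec_mulVec, star_dotProduct_mulVec_eq', conjTranspose_conjTranspose]
  have hxx : (star x ⬝ᵥ x).re = esy[fun k => φ k ^ 2, A, j] := by
    rw [hx, re_star_wcond_dotProduct_self]
  set a : ℝ := ∑ T ∈ A.powersetCard j, (∏ k ∈ T, φ k ^ 2) * ∑ k ∈ A \ T, W[k] * φ k with ha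
  have hxy : ‖star x ⬝ᵥ y‖ = |a| := by
    rw [hx, hy, hΨ', star_wcond_dotProduct_pairField_mulVec_wcond, norm_neg, Complex.norm_real,
      Real.norm_eq_abs]
  have hcs := norm_sq_star_dotProduct_le x y
  rw [hxy, hxx, sq_abs] at hcs
  rw [hR]
  exact hcs

/-! ### Mode-by-mode form of the channel sum -/

omit [NeZero L] in
/-- `Σ_{T ⊆ A, |T| = j} (Π_T x) Σ_{k ∈ A∖T} f_k = Σ_{k ∈ A} f_k · e_j(x; A∖{k})` (both sides sum
`f_k Π_T x` over the pairs `(T, k)` with `T ⊆ A ∖ {k}`, `|T| = j`). [folklore] -/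
theorem sum_prod_mul_sum_sdiff_eq (x f : TorusSite 2 L → ℝ) (A : Finset (TorusSite 2 L)) (j : ℕ) :
    ∑ T ∈ A.powersetCard j, (∏ k ∈ T, x k) * ∑ k ∈ A \ T, f k =
      ∑ k ∈ A, f k * esy[x, A.erase k, j] := by
  classical
  simp_rw [Finset.mul_sum]
  rw [Finset.sum_comm' (t' := A) (s' := fun k => (A.erase k).powersetCard j)]
  · refine Finset.sum_congr rfl fun k _ => ?_
    refine Finset.sum_congr rfl fun T _ => ?_
    ring
  · intro T k
    simp only [Finset.mem_powersetCard, Finset.mem_sdiff, Finset.subset_erase]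
    tauto

omit [NeZero L] in
/-- The kinetic sum mode by mode: `Σ_{S ⊆ A, |S| = j+1} (Π_S x) Σ_{k∈S} g_k =
Σ_{k∈A} g_k x_k e_j(x; A∖{k})` (each `S ∋ k` is `{k} ∪ T` with `T ⊆ A∖{k}`, `|T| = j`).
[folklore] -/
theorem sum_prod_mul_sum_mem_eq (x g : TorusSite 2 L → ℝ) (A : Finset (TorusSite 2 L)) (j : ℕ) :
    ∑ S ∈ A.powersetCard (j + 1), (∏ k ∈ S, x k) * ∑ k ∈ S, g k =
      ∑ k ∈ A, g k * (x k * esy[x, A.erase k, j]) := by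
  classical
  simp_rw [Finset.mul_sum]
  rw [Finset.sum_comm' (t' := A) (s' := fun k => (A.powersetCard (j + 1)).filter (fun S => k ∈ S))]
  · refine Finset.sum_congr rfl fun k hk => ?_
    -- `Σ_{S ∋ k} (Π_S x) g_k = g_k x_k e_j(x; A∖k)` via `S = insert k T`
    have himage : (A.powersetCard (j + 1)).filter (fun S => k ∈ S) =
        ((A.erase k).powersetCard j).image (insert k) := by
      ext S
      simp only [Finset.mem_filter, Finset.mem_powersetCard, Finset.mem_image]
      constructor
      · rintro ⟨⟨hSA, hSj⟩, hkS⟩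
        refine ⟨S.erase k, ⟨?_, ?_⟩, Finset.insert_erase hkS⟩
        · exact Finset.erase_subset_erase k hSA
        · rw [Finset.card_erase_of_mem hkS, hSj]; rfl
      · rintro ⟨T, ⟨hTA, hTj⟩, rfl⟩
        have hkT : k ∉ T := fun h => (Finset.mem_erase.1 (hTA h)).1 rfl
        refine ⟨⟨Finset.insert_subset hk ((hTA.trans (Finset.erase_subset k A))), ?_⟩,
          Finset.mem_insert_self k T⟩
        rw [Finset.card_insert_of_notMem hkT, hTj]
    rw [himage, Finset.sum_image]
    · refine Finset.sum_congr rfl fun T hT => ?_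
      have hkT : k ∉ T := fun h =>
        (Finset.mem_erase.1 ((Finset.mem_powersetCard.1 hT).1 h)).1 rfl
      rw [Finset.prod_insert hkT]
      ring
    · intro T₁ hT₁ T₂ hT₂ heq
      have h1 : k ∉ T₁ := fun h =>
        (Finset.mem_erase.1 ((Finset.mem_powersetCard.1 (Finset.mem_coe.1 hT₁)).1 h)).1 rfl
      have h2 : k ∉ T₂ := fun h =>
        (Finset.mem_erase.1 ((Finset.mem_powersetCard.1 (Finset.mem_coe.1 hT₂)).1 h)).1 rfl
      rw [← Finset.erase_insert h1, heq, Finset.erase_insert h2]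
  · intro S k
    simp only [Finset.mem_filter, Finset.mem_powersetCard]
    constructor
    · rintro ⟨⟨hSA, hSj⟩, hkS⟩
      exact ⟨⟨⟨hSA, hSj⟩, hkS⟩, hSA hkS⟩
    · rintro ⟨⟨⟨hSA, hSj⟩, hkS⟩, _⟩
      exact ⟨⟨hSA, hSj⟩, hkS⟩

end Summit.HubbardSuperconductivity.HubbardSuperconductivity.Theorems.WeightedCondensate
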